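import Mathlib

/-!
# TRIAGE r1 seat 1 (gen 3) — kernel checks behind paper claims in `TRIAGE-r1-1.md`

crux stmt-BirchSwinnertonDyer-19875 `SprungLowerDivisibilityAtThree`; seat refuter-cruxtriage-…-r1-1 (g3, 2026-08-28).
Evidence only: NO idea verdict changes; BSD / K1 / the X8 leaf are NOT proved by anything here.
`lean check`: rc 0, 0 errors, 0 warnings, 0 sorries; axioms {propext, Classical.choice, Quot.sound}
(`decide +kernel`, no `native_decide`). A deliberately false variant (card = 17 / 13) is REJECTED by the
same tactic (sanity run in the seat folder, `ScratchFalse.lean`).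

(1) GL₂(𝔽₃) facts used by `dihedral-elliptic-unit-anchor` F1 / LINE pencil-seed-transport S5
    (round-1 text: "the subgroups of GL₂(𝔽₃) containing a C₈ are exactly C₈, SD₁₆ = N(C_ns), GL₂(𝔽₃)";
    listed under "Not run: in-Lean `decide` of the GL₂(𝔽₃) subgroup fact (done on paper)").
    Encoding: `M = (a,b,c,d) ↔ !![a,b;c,d]` over `ZMod 3`; `mul`, `det`, `pw` hand-rolled so that
    `decide` runs in the kernel over the 81 matrices.
(2) small identities used on paper in the verdicts on `sharpflat-zeta-element-at-three`,
    `mixed-wronskian-squeeze`, ideator note N2.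
-/

set_option autoImplicit false
set_option linter.dupNamespace false

namespace Summit.BirchSwinnertonDyer.BirchSwinnertonDyer.Cruxes.SprungLowerDivisibilityAtThree.TriageR11

namespace GL2F3

abbrev M := ZMod 3 × ZMod 3 × ZMod 3 × ZMod 3

/-- matrix product of `!![x₁,x₂;x₃,x₄] * !![y₁,y₂;y₃,y₄]` -/
def mul (x y : M) : M :=
  (x.1 * y.1 + x.2.1 * y.2.2.1, x.1 * y.2.1 + x.2.1 * y.2.2.2,
   x.2.2.1 * y.1 + x.2.2.2 * y.2.2.1, x.2.2.1 * y.2.1 + x.2.2.2 * y.2.2.2)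

def one : M := (1, 0, 0, 1)
def negOne : M := (-1, 0, 0, -1)
def det (x : M) : ZMod 3 := x.1 * x.2.2.2 - x.2.1 * x.2.2.1

def pw (x : M) : ℕ → M
  | 0 => one
  | n + 1 => mul (pw x n) x

/-- `g` has order exactly 8 (then automatically invertible); `Bool`-valued so that it is data, not a `Prop` fact. -/
def ord8 (g : M) : Bool := decide (pw g 8 = one ∧ pw g 4 ≠ one)

/-- `x` is invertible and normalises `⟨g⟩` (for `g` of order 8 the conjugate `x g x⁻¹` is an odd power). -/
def normalises (g x : M) : Bool :=
  decide (det x ≠ 0 ∧ (mul x g = mul g x ∨ mul x g = mul (pw g 3) x ∨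
    mul x g = mul (pw g 5) x ∨ mul x g = mul (pw g 7) x))

/-- |GL₂(𝔽₃)| = 48 in this encoding (sanity). -/
theorem card_GL : (Finset.univ.filter fun x : M => det x ≠ 0).card = 48 := by decide +kernel

/-- there are exactly 12 elements of order 8 (= generators of the three non-split Cartans C_ns(3) ≅ 𝔽₉ˣ). -/
theorem count_ord8 : (Finset.univ.filter fun g : M => ord8 g = true).card = 12 := by decide +kernel

/-- Fact A: an element of order 8 has g⁴ = −I (so the unique involution of C₈ is −I, det +1). -/
theorem ord8_pow_four : ∀ g : M, ord8 g → pw g 4 = negOne := by decide +kernel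

/-- Fact A′: generators of C_ns(3) have determinant −1 (consistent with det ρ̄ = ω non-trivial on tame inertia). -/
theorem ord8_det : ∀ g : M, ord8 g → det g = -1 := by decide +kernel

/-- Fact B: SL₂(𝔽₃) has no element of order 8. -/
theorem sl2_no_ord8 : ∀ g : M, det g = 1 → pw g 8 = one → pw g 4 = one := by decide +kernel

/-- Fact C: the normaliser of every C₈ = ⟨g⟩ in GL₂(𝔽₃) has exactly 16 elements (= N(C_ns(3)) ≅ SD₁₆). -/
theorem normaliser_card : ∀ g : M, ord8 g → (Finset.univ.filter fun x : M => normalises g x = true).card = 16 := by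
  decide +kernel

/-- Fact C′: the normaliser is non-abelian: some invertible x acts on ⟨g⟩ by g ↦ g³ (Frobenius x ↦ x³ on 𝔽₉ˣ). -/
theorem exists_cube_conjugator : ∀ g : M, ord8 g → ∃ x : M, det x ≠ 0 ∧ mul x g = mul (pw g 3) x := by
  decide +kernel

/-- Fact D: every involution inside C₈ = ⟨g⟩ has determinant +1 (so an involution of det −1,
    e.g. complex conjugation, is never in C₈: the global image is not C₈ and K′ is imaginary). -/
theorem involution_in_C8_det_one :
    ∀ g : M, ord8 g → ∀ k : Fin 8, mul (pw g k) (pw g k) = one → det (pw g k) = 1 := by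
  decide +kernel

/-- Fact D′: the normaliser N(⟨g⟩) does contain an involution of determinant −1 outside ⟨g⟩
    (so image = N(C_ns(3)) is compatible with complex conjugation). -/
theorem exists_odd_involution_in_normaliser :
    ∀ g : M, ord8 g → ∃ x : M, normalises g x = true ∧ mul x x = one ∧ det x = -1 := by
  decide +kernel

/-- Fact E: the squares of GL₂(𝔽₃) form a 16-element set (all of determinant 1); since 16 > 12 they
    generate SL₂(𝔽₃), so SL₂(𝔽₃) is the UNIQUE index-2 subgroup (an index-2 subgroup contains all squares). -/
theorem squares_card :
    ((Finset.univ.filter fun x : M => det x ≠ 0).image fun x => mul x x).card = 16 := by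
  decide +kernel

theorem squares_det_one : ∀ x : M, det x ≠ 0 → det (mul x x) = 1 := by decide +kernel


/-- matrix-vector product `!![a,b;c,d] (v₁,v₂)ᵀ`. -/
def app (x : M) (v : ZMod 3 × ZMod 3) : ZMod 3 × ZMod 3 :=
  (x.1 * v.1 + x.2.1 * v.2, x.2.2.1 * v.1 + x.2.2.2 * v.2)

/-- Fact F: C₈ = C_ns(3) acts irreducibly on 𝔽₃² (no eigenline), so ρ̄ is irreducible already on
    inertia at a good-supersingular 3. -/
theorem ord8_no_eigenline :
    ∀ g : M, ord8 g → ∀ v : ZMod 3 × ZMod 3, v ≠ 0 → ∀ c : ZMod 3, app g v ≠ (c * v.1, c * v.2) := by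
  decide +kernel

/-- Fact G: the commutant of N(C₈) = ⟨g, x⟩ (x a cube-conjugator) in M₂(𝔽₃) is exactly the 3 scalars:
    End_{G_{ℚ₃}}(W[3]) = 𝔽₃ for the local image N(C_ns(3)) (used in `hesse-pencil-seed-transport`
    evidence (b): the symplectic type of a 3-congruence is a well-defined invariant). -/
theorem commutant_of_normaliser_card :
    ∀ g : M, ord8 g → ∀ x : M, (det x ≠ 0 ∧ mul x g = mul (pw g 3) x) →
      (Finset.univ.filter fun a : M => mul a g = mul g a ∧ mul a x = mul x a).card = 3 := by
  decide +kernel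

/-- whereas the commutant of C₈ alone is the 9-element field 𝔽₉ = 𝔽₃[g]. -/
theorem commutant_of_C8_card :
    ∀ g : M, ord8 g → (Finset.univ.filter fun a : M => mul a g = mul g a).card = 9 := by
  decide +kernel

/-!
Paper glue (3 lines, recorded in TRIAGE-r1-1.md gen-3 addendum): let C₈ ≤ H ≤ GL₂(𝔽₃).
|H| ∈ {8, 16, 24, 48}. |H| = 24 ⇒ H has index 2 ⇒ H ⊇ ⟨squares⟩ = SL₂(𝔽₃) (Fact E) ⇒ H = SL₂(𝔽₃),
contradicting Fact B. |H| = 16 ⇒ [H : C₈] = 2 ⇒ C₈ ⊲ H ⇒ H ≤ N(C₈), |N(C₈)| = 16 (Fact C) ⇒ H = N(C₈).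
So H ∈ {C₈, N(C_ns(3)), GL₂(𝔽₃)}; with the local image at a good-supersingular 3 already = N(C_ns(3))
(inertia ↦ C₈ via ω₂, Frobenius ↦ the cube-conjugator of Fact C′, which is ∉ C₈ since C₈ is abelian),
a NON-surjective X8 image is exactly N(C_ns(3)); Fact D ⇒ complex conjugation ∉ C₈ ⇒ the quadratic field
K′ cut out by C₈ is imaginary, and Frob₃ ∉ C₈ ⊇ ρ̄(I₃) ⇒ 3 is inert in K′.
-/

end GL2F3

/-! (2) small identities -/
namespace Arith

/-- companion matrix of X² ∓ 3X + 3 (Frobenius on the Tate module at a₃ = ±3): C⁶ = −27·I. -/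
theorem companion_pow_six_plus : (!![(3 : ℤ), 1; -3, 0]) ^ 6 = !![-27, 0; 0, -27] := by decide +kernel
theorem companion_pow_six_minus : (!![(-3 : ℤ), 1; -3, 0]) ^ 6 = !![-27, 0; 0, -27] := by decide +kernel

/-- Euler factor at s = 1: (1 − 1/α)(1 − 1/β) = (p + 1 − a_p)/p with α + β = a, αβ = p (here p = 3). -/
theorem euler_factor (α β a : ℚ) (hs : α + β = a) (hp : α * β = 3) :
    (1 - 1/α) * (1 - 1/β) = (4 - a) / 3 := by
  have hα : α ≠ 0 := by rintro rfl; simp at hp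
  have hβ : β ≠ 0 := by rintro rfl; simp at hp
  calc (1 - 1/α) * (1 - 1/β) = 1 - (α + β) / (α * β) + 1 / (α * β) := by field_simp; ring
    _ = (4 - a) / 3 := by rw [hs, hp]; ring

/-- so #Ẽ(𝔽₃)/3 ∈ {1/3, 7/3} on X8 (a₃ = ±3). -/
example : (4 - (3 : ℚ)) / 3 = 1/3 ∧ (4 - (-3 : ℚ)) / 3 = 7/3 := by norm_num

/-- a_{p³} = a_p³ − 2p·a_p − p·a_p·1 ... recursion a_{p^{n+1}} = a_p a_{p^n} − p a_{p^{n−1}}: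
    a_9 = a² − 6 → wait p = 3: a_9 = a₃² − 2·3, a_27 = a₃·a_9 − 3·a₃ = a₃³ − 9a₃; vanishes at a₃ = ±3
    (ideator N2 'Chebyshev node': a₂₇ = 0 on all of X8). -/
theorem a27_vanishes (a : ℤ) (h : a = 3 ∨ a = -3) : a * (a * a - 2 * 3) - 3 * a = 0 := by
  rcases h with rfl | rfl <;> norm_num

/-- (α − β)² = (α + β)² − 4αβ = a₃² − 12 = −3 at a₃ = ±3, so v₃(α − β) = 1/2 (sharpflat-zeta F1 set-up). -/
theorem disc_at_three (a : ℤ) (ha : a = 3 ∨ a = -3) : a ^ 2 - 4 * 3 = -3 := by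
  rcases ha with rfl | rfl <;> norm_num

end Arith

end Summit.BirchSwinnertonDyer.BirchSwinnertonDyer.Cruxes.SprungLowerDivisibilityAtThree.TriageR11
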